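import Mathlib.AlgebraicGeometry.Sites.ElladicCohomology
import Mathlib.Topology.Algebra.Module.ModuleTopology
import Mathlib.NumberTheory.Padics.PadicIntegers
import Mathlib.RepresentationTheory.Invariants
import Mathlib.Topology.Algebra.Monoid
import Literature.NumberTheory.GaloisRepresentations.GaloisRep
import Literature.AlgebraicGeometry.Motives.GaloisRealization
import Literature.AlgebraicGeometry.Motives.BettiRealization
import Literature.AlgebraicGeometry.Motives.Comparison
import Literature.AlgebraicGeometry.Motives.BaseChange
import HarnessLib

-- provenance: harness21/H21/H21/Prelude/MotiveL/EtaleRealization.lean @ 4709b91 (interim HEAD d8f2665); M5 mechanical rewrite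
/-!
# The ℓ-adic (étale) realization (trunk MotiveL, prelude C5)

The ℓ-adic étale cohomology `X ↦ H•_ét(X_{k̄}, ℚ_ℓ)` of smooth projective varieties over a
field `k` (`ℓ ≠ char k`) is a Weil cohomology theory carrying a *continuous* `ℚ_ℓ`-linear action
of `Γ_k = Gal(k̄/k)`, with Tate twists given by the ℓ-adic cyclotomic character, and with the
classes of `k`-rational algebraic cycles Galois invariant in `H²ᵖ(p)` (SGA 4½ [Arcata], [Cycle];
Tate 1994 §1; Deligne 1982 §1). Over `k ⊆ ℂ`, Artin's comparison theorem identifies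
`H•_B(X_σ(ℂ), ℚ) ⊗ ℚ_ℓ ≅ H•_ét(X_{k̄}, ℚ_ℓ)` (SGA 4 XI 4.4).

This file packages this as a **hypothesis structure** `Literature.EtaleRealization k ℓ` extending the
accepted `Literature.GaloisWeilCohomology k ℚ_[ℓ] (padicCyclotomicCharacter k ℓ)` (G17) by the single
`Prop` field `continuous_ρ` (joint continuity of `Γ_k × Hⁱ(X) → Hⁱ(X)` for the Krull topology
on `Γ_k` and the `ℚ_ℓ`-module topology on the finite-dimensional `Hⁱ(X)`), plus honest glue to
the accepted GalRep trunk (`Literature.NumberTheory.GaloisRepresentations.GaloisRep`).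

## Main definitions

* `Literature.WithModuleTopology K V` : type synonym for a `K`-module `V` equipped with the module
  topology `moduleTopology K V` (Mathlib `IsModuleTopology`); `WithModuleTopology.rep ρ` retypes
  a representation on it.
* `Literature.EtaleRealization k ℓ` : the hypothesis structure (value candidate: ℓ-adic cohomology).
* `E.V X i`, `E.galoisRep X i : GaloisRep k ℚ_[ℓ] (E.V X i)` : `Hⁱ(X)` as a continuous Galois
  representation in the sense of the GalRep trunk; `E.galoisRepTwist X i j` : its Tate twist
  `Hⁱ(X)(j)`.
* `Literature.AlgebraicGeometry.Motives.padicCyclotomicCharacter_eq_unitsMap_comp`, `Literature.AlgebraicGeometry.Motives.continuous_padicCyclotomicCharacter` :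
  G17's `ℚ_ℓˣ`-valued cyclotomic character is G09's continuous `ℤ_ℓˣ`-valued one pushed to
  `ℚ_ℓˣ`, hence continuous.
* `E.chowGroupCycleMap_mem_invariants_twist` : the ℓ-adic cycle class map
  `CHᵖ(X) → H²ᵖ(X)(p)` lands in the `Γ_k`-invariants.
* `E.IsProetaleModel` : pin to Mathlib's pro-étale `Scheme.EllAdicCohomology`
  (Bhatt–Scholze 2015, §5.6, Def. 6.8.1): `Hⁱ(X) ≃+ ℚ ⊗_ℤ Hⁱ_proét(X_{k̄}, ℤ_ℓ)` as groups
  (a predicate on `E`, to be assumed as a hypothesis where needed; not a theorem about every `E`).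
* `Literature.ArtinComparison E B σ` : Artin comparison data between `E` and Betti–Hodge data `B` over
  `ℂ` along `σ : k →+* ℂ`, an `abbrev` for the accepted `Literature.AlgebraicGeometry.Motives.WeilComparison` with the Betti side
  pulled back along `σ` (`PreWeilCohomology.comap σ`, C0).

## Interop with the GalRep trunk

With `K : Type` a number field, `E : EtaleRealization K ℓ`, `v : HeightOneSpectrum (𝓞 K)`, the
following accepted G09 notions elaborate as is on `E.galoisRep X i` (checked in the architect's
probe; binder orders `(v) (ρ)`): `GaloisRep.artinConductorExponent v (E.galoisRep X i)`
(`Literature.Prelude.GalRep.ArtinConductor`), `(E.galoisRep X i).IsUnramifiedAt v`,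
`(E.galoisRep X i).toLocal v` (`Literature.Prelude.GalRep.GaloisRep`), and
`GaloisRep.IsGeometric 𝔅 (E.galoisRep X i)` (`Literature.Prelude.GalRep.PAdicHodge`). They are not
imported here to keep the dependency cone small.

## Mathlib searches / design choices

* Mathlib has `moduleTopology`/`IsModuleTopology` (with `IsModuleTopology.toContinuousAdd`,
  `IsModuleTopology.continuousSMul`), `Scheme.EllAdicCohomology` (groups only: no `ℚ_ℓ`-module
  structure, functoriality or Galois action yet), `cyclotomicCharacter` and its continuity; all
  are used. Mathlib has no type synonym "module with its module topology" (searched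
  `WithModuleTopology`, `ModuleTopology` synonyms: none), so `WithModuleTopology` is defined here
  with instances taking *explicit* binders (no instance on a Mathlib type is overridden: the
  carrier is a fresh `def`).
* `EtaleRealization` has **no** duplicated `galoisRep` data and **no** compatibility axiom with
  Mathlib's étale cohomology: one `Prop` field keeps it a value candidate; the relation to
  `Scheme.EllAdicCohomology` is the separate predicate `IsProetaleModel`.
* `ArtinComparison` has no Galois-compatibility field (this would need an extension
  `σ̄ : k̄ →+* ℂ` of `σ`); its cycle-class compatibility (`WeilComparison.iso_cycleClass`) is
  against `(B.W.comap σ).cycleClass X p z = ∑_{z' over z} cl_B(z')`, i.e. against `cl_B(Z_σ)`.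
* Universes: `k : Type u` throughout, except `ArtinComparison` where `k : Type` (Betti side).

## References

* M. Artin, A. Grothendieck, J.-L. Verdier, SGA 4, Exp. XI, Thm. 4.4 (comparison theorem).
* P. Deligne, SGA 4½, [Arcata], [Cycle]; P. Deligne, *Hodge cycles on abelian varieties* (1982), §1.
* J. Tate, *Conjectures on algebraic cycles in ℓ-adic cohomology*, PSPM 55 (1994), §1.
* B. Bhatt, P. Scholze, *The pro-étale topology for schemes*, Astérisque 369 (2015), §5.6, §6.8.
-/

universe u v

open CategoryTheory AlgebraicGeometry
open scoped TensorProduct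

noncomputable section

namespace Literature.AlgebraicGeometry.Motives

/-! ## A module equipped with its module topology -/

/-- Type synonym: the `K`-module `V` equipped with the **module topology** `moduleTopology K V`
(the finest topology making it a topological `K`-module; for `V` finite free this is the product
topology of `Kⁿ`, Mathlib `IsModuleTopology`). Used to view the (untopologised) cohomology groups
`Hⁱ(X)` of a Weil cohomology theory over `ℚ_ℓ` as topological `ℚ_ℓ`-vector spaces.
Ref: Mathlib `Mathlib/Topology/Algebra/Module/ModuleTopology.lean`. [folklore] -/
@[nolint unusedArguments]
def WithModuleTopology (K : Type*) (V : Type*) [TopologicalSpace K] [Ring K] [AddCommGroup V]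
    [Module K V] : Type _ := V

namespace WithModuleTopology

variable (K : Type*) (V : Type*) [TopologicalSpace K] [Ring K] [AddCommGroup V] [Module K V]

/-- The additive group structure on `WithModuleTopology K V` is that of `V`. [folklore] -/
instance instAddCommGroup : AddCommGroup (WithModuleTopology K V) := inferInstanceAs (AddCommGroup V)

/-- The `K`-module structure on `WithModuleTopology K V` is that of `V`. [folklore] -/
instance instModule : Module K (WithModuleTopology K V) := inferInstanceAs (Module K V)

/-- `WithModuleTopology K V` carries the module topology (Mathlib `moduleTopology`). [folklore] -/
instance instTopologicalSpace : TopologicalSpace (WithModuleTopology K V) := moduleTopology K V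

/-- By definition the topology on `WithModuleTopology K V` is the module topology. [folklore] -/
instance instIsModuleTopology : IsModuleTopology K (WithModuleTopology K V) := ⟨rfl⟩

/-- Addition on `WithModuleTopology K V` is continuous (Mathlib
`IsModuleTopology.toContinuousAdd`). [folklore] -/
instance instContinuousAdd : ContinuousAdd (WithModuleTopology K V) :=
  IsModuleTopology.toContinuousAdd K _

/-- Scalar multiplication on `WithModuleTopology K V` is continuous (Mathlib
`IsModuleTopology.toContinuousSMul`). [folklore] -/
instance instContinuousSMul : ContinuousSMul K (WithModuleTopology K V) :=
  IsModuleTopology.toContinuousSMul K _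

/-- Retype a representation of `G` on `V` as a representation on `WithModuleTopology K V`
(the identity). [folklore] -/
def rep {G : Type*} [Monoid G] (ρ : Representation K G V) :
    Representation K G (WithModuleTopology K V) := ρ

/-- Unfolding lemma for `WithModuleTopology.rep`. [folklore] -/
@[simp] lemma rep_apply {G : Type*} [Monoid G] (ρ : Representation K G V) (g : G) :
    rep K V ρ g = ρ g := rfl

end WithModuleTopology

/-! ## The ℓ-adic cyclotomic character is continuous -/

section Cyclotomic

variable (k : Type u) [Field k] (ℓ : ℕ) [Fact ℓ.Prime]

/-- G17's `ℚ_ℓˣ`-valued cyclotomic character `padicCyclotomicCharacter k ℓ` is, by construction,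
the continuous `ℤ_ℓˣ`-valued cyclotomic character of the GalRep trunk
(`GaloisRep.cyclotomicCharacter k ℓ`) composed with `ℤ_ℓˣ → ℚ_ℓˣ`
(Serre 1968, I §1.2; Tate 1994 §1). [cite: Serre1968, I §1.2] -/
theorem padicCyclotomicCharacter_eq_unitsMap_comp :
    padicCyclotomicCharacter k ℓ =
      (Units.map ↑(PadicInt.Coe.ringHom (p := ℓ))).comp
        (Literature.NumberTheory.GaloisRepresentations.GaloisRep.cyclotomicCharacter k ℓ).toMonoidHom := rfl

/-- The `ℚ_ℓˣ`-valued cyclotomic character `Γ_k → ℚ_ℓˣ` is continuous (Serre 1968, I §1.2), from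
Mathlib's `cyclotomicCharacter.continuous` via `GaloisRep.cyclotomicCharacter`. [cite: Serre1968, I §1.2] -/
theorem continuous_padicCyclotomicCharacter : Continuous (padicCyclotomicCharacter k ℓ) := by
  rw [padicCyclotomicCharacter_eq_unitsMap_comp]
  exact (Continuous.units_map _ (continuous_subtype_val :
      Continuous (PadicInt.Coe.ringHom (p := ℓ)))).comp
    (Literature.NumberTheory.GaloisRepresentations.GaloisRep.cyclotomicCharacter k ℓ).continuous_toFun

/-- The map `g ↦ (χ_ℓ(g) : ℚ_ℓ) ^ j`, `j : ℤ`, is continuous on `Γ_k`. [folklore] -/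
theorem continuous_padicCyclotomicCharacter_zpow (j : ℤ) :
    Continuous fun g : Field.absoluteGaloisGroup k ↦ ((padicCyclotomicCharacter k ℓ g : ℚ_[ℓ]) ^ j) := by
  have h : Continuous fun g : Field.absoluteGaloisGroup k ↦ padicCyclotomicCharacter k ℓ g ^ j :=
    (continuous_padicCyclotomicCharacter k ℓ).zpow j
  have h' := Units.continuous_val.comp h
  simp only [Function.comp_def, Units.val_zpow_eq_zpow_val] at h'
  exact h'

end Cyclotomic

/-! ## The étale realization -/

/-- The **ℓ-adic (étale) realization** over a field `k` (hypothesis structure; SGA 4½ [Arcata],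
[Cycle]; Tate 1994 §1; Deligne 1982 §1): a Weil cohomology theory with `ℚ_ℓ` coefficients and
Galois action twisted by the ℓ-adic cyclotomic character (`GaloisWeilCohomology k ℚ_[ℓ]
(padicCyclotomicCharacter k ℓ)`: equivariant pull-backs and cup products, invariant trace on
`H²ⁿ(n)`, Galois-invariant cycle classes in `H²ᵖ(p)`) whose action maps
`Γ_k × Hⁱ(X) → Hⁱ(X)` are jointly continuous for the Krull topology on `Γ_k` and the
`ℚ_ℓ`-module topology on `Hⁱ(X)`. The intended value is `X ↦ H•_ét(X_{k̄}, ℚ_ℓ)`, `ℓ ≠ char k`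
(see `IsProetaleModel` for the pin to Mathlib's `Scheme.EllAdicCohomology`). [cite: Tate1994, §1] -/
structure EtaleRealization (k : Type u) [Field k] (ℓ : ℕ) [Fact ℓ.Prime] extends
    GaloisWeilCohomology k ℚ_[ℓ] (padicCyclotomicCharacter k ℓ) where
  /-- The Galois action `Γ_k × Hⁱ(X) → Hⁱ(X)` is jointly continuous for the ℓ-adic (module)
  topology on `Hⁱ(X)` (SGA 4½ [Arcata] V; Serre 1968, I §1.1). -/
  continuous_ρ : ∀ (X : SchemeOver k) (i : ℕ),
    Continuous fun p : Field.absoluteGaloisGroup k ×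
        WithModuleTopology ℚ_[ℓ] (toPreWeilCohomology.obj X i) ↦
      WithModuleTopology.rep ℚ_[ℓ] _ (ρ X i) p.1 p.2

namespace EtaleRealization

variable {k : Type u} [Field k] {ℓ : ℕ} [Fact ℓ.Prime] (E : EtaleRealization k ℓ)

/-- The topological `ℚ_ℓ`-vector space `Hⁱ(X)`: the group `E.obj X i` with its module topology. [folklore] -/
abbrev V (X : SchemeOver k) (i : ℕ) : Type u := WithModuleTopology ℚ_[ℓ] (E.obj X i)

/-- `Hⁱ(X)` as a **continuous Galois representation** `Γ_k → GL(Hⁱ(X))` in the sense of the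
GalRep trunk (`Literature.NumberTheory.GaloisRepresentations.GaloisRep`; Serre 1968, I §1.1; SGA 4½ [Arcata]). [cite: Serre1968, I §1.1] -/
def galoisRep (X : SchemeOver k) (i : ℕ) : Literature.NumberTheory.GaloisRepresentations.GaloisRep k ℚ_[ℓ] (E.V X i) :=
  ⟨WithModuleTopology.rep ℚ_[ℓ] _ (E.ρ X i), E.continuous_ρ X i⟩

/-- `E.galoisRep X i g v = E.ρ X i g v`. [folklore] -/
@[simp] lemma galoisRep_apply (X : SchemeOver k) (i : ℕ) (g : Field.absoluteGaloisGroup k)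
    (v : E.V X i) : E.galoisRep X i g v = E.ρ X i g v := rfl

/-- The representation underlying `E.galoisRep X i` is `E.ρ X i`. [folklore] -/
lemma galoisRep_toRepresentation (X : SchemeOver k) (i : ℕ) :
    (E.galoisRep X i).toRepresentation = WithModuleTopology.rep ℚ_[ℓ] _ (E.ρ X i) := rfl

/-- The **Tate twist** `Hⁱ(X)(j)` as a continuous Galois representation:
`g ↦ χ_ℓ(g)ʲ • ρ(g)` (G17 `ρTwist`; Tate 1994 §1). Continuity from
`continuous_padicCyclotomicCharacter` and continuity of the scalar action for the module
topology. [cite: Tate1994, §1] -/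
def galoisRepTwist (X : SchemeOver k) (i : ℕ) (j : ℤ) : Literature.NumberTheory.GaloisRepresentations.GaloisRep k ℚ_[ℓ] (E.V X i) where
  toRepresentation := WithModuleTopology.rep ℚ_[ℓ] _ (E.ρTwist X i j)
  continuous_smul := by
    have h : Continuous fun p : Field.absoluteGaloisGroup k × E.V X i ↦
        ((padicCyclotomicCharacter k ℓ p.1 : ℚ_[ℓ]) ^ j) • E.galoisRep X i p.1 p.2 :=
      ((continuous_padicCyclotomicCharacter_zpow k ℓ j).comp continuous_fst).smul
        (E.continuous_ρ X i)
    exact h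

/-- `E.galoisRepTwist X i j g v = χ_ℓ(g)ʲ • E.ρ X i g v`. [folklore] -/
@[simp] lemma galoisRepTwist_apply (X : SchemeOver k) (i : ℕ) (j : ℤ)
    (g : Field.absoluteGaloisGroup k) (v : E.V X i) :
    E.galoisRepTwist X i j g v = ((padicCyclotomicCharacter k ℓ g : ℚ_[ℓ]) ^ j) • E.ρ X i g v :=
  rfl

/-- The representation underlying `E.galoisRepTwist X i j` is G17's `E.ρTwist X i j`. [folklore] -/
lemma galoisRepTwist_toRepresentation (X : SchemeOver k) (i : ℕ) (j : ℤ) :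
    (E.galoisRepTwist X i j).toRepresentation = WithModuleTopology.rep ℚ_[ℓ] _ (E.ρTwist X i j) :=
  rfl

/-- `Hⁱ(X)(0) = Hⁱ(X)` as continuous Galois representations. [folklore] -/
@[simp] lemma galoisRepTwist_zero (X : SchemeOver k) (i : ℕ) :
    E.galoisRepTwist X i 0 = E.galoisRep X i := by
  ext g v
  simp

/-- `Hⁱ(X)` is finite dimensional over `ℚ_ℓ` for `X` smooth projective (SGA 4½ [Arcata] V 3.1;
from the Weil-cohomology axiom `finite_obj`). [folklore] -/
theorem finite_V {n : ℕ} {X : SchemeOver k} (hX : IsSmoothProjective n X) (i : ℕ) :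
    Module.Finite ℚ_[ℓ] (E.V X i) :=
  E.finite_obj hX i

/-- **The ℓ-adic cycle class map is `Γ_k`-equivariant into `H²ᵖ(X)(p)`**: for `X` smooth
projective of dimension `n = p + d`, the class of every `d`-cycle class `x ∈ CH_d(X)` is
invariant under the twisted action `E.galoisRepTwist X (2p) p` (Tate 1994 §1; SGA 4½ [Cycle]
2.2). From G17 `cycleClass_ρ` via `algebraicClasses_le_invariants`; the class of a cycle lies in
the algebraic lattice by `cycleClass_mem_algebraicLattice` and the vanishing of junk values
`cycleClass_eq_zero_of_coheight_ne`. The instance hypothesis `[CompactSpace X.left]` (needed by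
`WeilCohomology.chowGroupCycleMap`) is supplied for smooth projective `X` by the named fact
`IsSmoothProjective.compactSpace` (`Varieties`). [cite: Tate1994, §1] -/
theorem chowGroupCycleMap_mem_invariants_twist {n : ℕ} {X : SchemeOver k}
    (hX : IsSmoothProjective n X) [CompactSpace X.left] {p d : ℕ} (h : p + d = n)
    (x : ChowGroup X.left d) :
    (E.chowGroupCycleMap hX h x : E.V X (2 * p)) ∈
      (E.galoisRepTwist X (2 * p) p).invariants := by
  have hmem : E.chowGroupCycleMap hX h x ∈ E.algebraicLattice X p := by
    induction x using ChowGroup.induction_on with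
    | h c =>
      rw [WeilCohomology.chowGroupCycleMap_mk]
      change (∑ᶠ z, (c : AlgebraicCycle X.left ℤ) z • E.cycleClass X p z) ∈ E.algebraicLattice X p
      refine finsum_induction (fun y ↦ y ∈ E.algebraicLattice X p) (zero_mem _)
        (fun _ _ hx hy ↦ add_mem hx hy) fun z ↦ ?_
      by_cases hz : Order.coheight z = p
      · exact AddSubgroup.zsmul_mem _ (E.cycleClass_mem_algebraicLattice X p hz) _
      · rw [E.cycleClass_eq_zero_of_coheight_ne hX p z hz, smul_zero]
        exact zero_mem _
  exact E.algebraicClasses_le_invariants hX p (E.algebraicLattice_le_algebraicClasses X p hmem)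

/-- **Pin to Mathlib's pro-étale ℓ-adic cohomology** (Bhatt–Scholze 2015, §5.6 and Def. 6.8.1):
`E` is a pro-étale model if each group `Hⁱ(X)` is (abstractly) isomorphic, as an additive group,
to `ℚ ⊗_ℤ Hⁱ_proét(X_{k̄}, ℤ_ℓ)` where `X_{k̄}` is the base change to `AlgebraicClosure k` and
`Hⁱ_proét` is Mathlib's `Scheme.EllAdicCohomology`. Only the groups are compared: Mathlib's
`EllAdicCohomology` has no `ℚ_ℓ`-module structure, functoriality or Galois action yet.
This is a **predicate** on the hypothesis structure `E` (the binder `E` is explicit), meant to be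
assumed as a hypothesis `(h : E.IsProetaleModel)` where the pin is needed; it is *not* a claim
about every `E : EtaleRealization k ℓ` — the groups `E.obj X i` are unconstrained data for `X`
not smooth projective and the structure carries no hypothesis `ℓ ≠ char k` — and no source
asserts it for an abstract `E`. The cited result concerns the comparison target only:
`Hⁱ_cont(Y_ét, (F_m)_m) ≃ Hⁱ(Y_proét, lim_m ν* F_m)` for pro-systems with surjective transition
maps (Bhatt–Scholze Prop. 5.6.2), with `𝓞_{E,Y} = lim_m 𝓞_E/ϖᵐ` the sheaf of Def. 6.8.1
(Lemma 6.8.2 (1)). [cite: BhattScholze2015, §5.6 Prop. 5.6.2 and Def. 6.8.1] -/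
def IsProetaleModel (E : EtaleRealization k ℓ) : Prop :=
  ∀ (X : SchemeOver k) (i : ℕ),
    Nonempty (E.obj X i ≃+
      ℚ ⊗[ℤ] ((baseChange k (AlgebraicClosure k)).obj X).left.EllAdicCohomology ℓ i)

/-- Unfolding lemma for `IsProetaleModel`. [folklore] -/
lemma isProetaleModel_iff : E.IsProetaleModel ↔ ∀ (X : SchemeOver k) (i : ℕ),
    Nonempty (E.obj X i ≃+
      ℚ ⊗[ℤ] ((baseChange k (AlgebraicClosure k)).obj X).left.EllAdicCohomology ℓ i) :=
  Iff.rfl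

end EtaleRealization

/-! ## Artin comparison -/

/-- **Artin comparison data** between an étale realization `E` over `k` and Betti–Hodge data `B`
over `ℂ`, along an embedding `σ : k →+* ℂ` (Artin's comparison theorem
`H•(X_σ(ℂ), ℚ) ⊗_ℚ ℚ_ℓ ≅ H•_ét(X_{k̄}, ℚ_ℓ)`, SGA 4 XI Thm. 4.4; Deligne–Milne 1982, I §1): the
accepted `WeilComparison` over `L = ℚ_ℓ` between `E` and the Betti theory pulled back along `σ`
(`PreWeilCohomology.comap σ`, so `(B.W.comap σ).obj X i = B.W.obj X_σ i`). It inherits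
`WeilComparison.isoEquiv`, `.symm`, `.periodField`, `.isHomologicallyTrivial_iff`. The
cycle-class compatibility `iso_cycleClass` is against `(B.W.comap σ).cycleClass X p z`, the sum
of the Betti classes of the points of `X_σ` over `z`, i.e. `cl_B(Z_σ)`. There is deliberately no
Galois-compatibility field (it would require an extension `σ̄ : k̄ →+* ℂ` of `σ`). [cite: DeligneMilne1982, I §1] -/
abbrev ArtinComparison {k : Type} [Field k] {ℓ : ℕ} [Fact ℓ.Prime] (E : EtaleRealization k ℓ)
    (B : BettiHodgeData ℂ) (σ : k →+* ℂ) : Type _ :=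
  WeilComparison E.toPreWeilCohomology (B.W.toPreWeilCohomology.comap σ) ℚ_[ℓ]

end Literature.AlgebraicGeometry.Motives

end
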